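/-
Copyright (c) 2026. All rights reserved.
Released under Apache 2.0 license as described in the file LICENSE.
Authors: abc-iut cell — seat abc-iut-w4-d104 (gen 2): proof-only — the germ MODEL of [AbsTopIII] Prop 2.6
(planar, this seat's gen 0) read on a Riemann surface: chart-independence of the multipliers of `𝒜_x`
(the "manifold version" junction of SUBDAG Cor-27 row e.r19).
-/
import Literature.AnabelianGeometry.AbsoluteAnabelian.HolomorphicCoresGermConjugation
import Mathlib.Geometry.Manifold.IsManifold.ExtChartAt
import Mathlib.Analysis.Calculus.Deriv.Inverse
import HarnessLib

/-!
# [AbsTopIII] Prop 2.6 (a) / Cor 2.7 (e) on a Riemann surface: the multipliers of `𝒜_x` do not depend on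
# the chart

S. Mochizuki, *Topics in absolute anabelian geometry III* (bib key `MochizukiAbsTopIII2015`), Cor 2.7 (e)
(kurims p.60): for an (elliptically admissible) Aut-holomorphic orbispace `𝕏` and `p ∈ X^top`, the group
`𝒜_p` "of automorphisms of the projective system of connected open neighborhoods of `p` … compatible with the
local additive structures … [cf. Proposition 2.6, (a)]", with "topological field structures on `𝒜_p ∪ {0}`,
together with compatible isomorphisms `𝒜_p ⥲ 𝒜_{p'}`".

The germ MODEL of Prop 2.6 (`HolomorphicCoresLocalLinearProofs.lean`, abc-iut-w4-d104 gen 0) is PLANAR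
(`U ⊆ ℂ`): `𝒜_p = germAut p` = the germs `z ↦ p + c (z − p)`, labelled by the multiplier `c ∈ ℂ^×`
(`germAutIsoUnits`).  On a Riemann surface `X` (Mathlib: `ChartedSpace ℂ X`, `IsManifold 𝓘(ℂ, ℂ) ω X`) the
group at `x ∈ X` is read in a chart; SUBDAG Cor-27 row e.r19 (plan/L4) records the junction "`𝒜_x` =
`germAut` transported by a chart" as UNTYPED.  This PROOF-ONLY file types and proves the one fact that
makes that junction well defined:

* `hasDerivAt_extChartAt_transition` — the transition map between two extended charts at `x` is
  complex-differentiable at the image point (from Mathlib's `contDiffWithinAt_ext_coord_change`);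
* `deriv_extChartAt_transition_mul_eq_one` — the derivatives of the two transition maps are mutually
  inverse (so non-zero);
* `hasDerivAt_extChartAt_transition_conj_mulAffine` — **chart-independence of `𝒜_x`**: conjugating the
  affine representative `z ↦ p₁ + c (z − p₁)` of a germ of `𝒜_{p₁}` in the chart at `y₁` (`p₁` = image of
  `x`) by the transition map to the chart at `y₂` gives a map with complex derivative `c` at `p₂`: the
  MULTIPLIER — hence the identification `ℂ^× ⥲ 𝒜_x` — is the same in every holomorphic chart (by
  `hasDerivAt_conj_mulAffine` of `HolomorphicCoresGermConjugation.lean`; recall from that file that the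
  conjugated GERM itself need not be affine).

Refereed pre-IUT material ([AbsTopIII] §2); nothing here bears on the disputed [IUTchIII] Cor. 3.12;
typed ≠ endorsed.  No new definitions.
-/

namespace Literature.AnabelianGeometry.AbsoluteAnabelian

open _root_.Complex _root_.Set _root_.Topology _root_.Filter _root_.Metric
open scoped _root_.Manifold _root_.ContDiff

noncomputable section

section Charts

variable {X : Type*} [TopologicalSpace X] [ChartedSpace ℂ X] [IsManifold 𝓘(ℂ, ℂ) ω X]

omit [IsManifold 𝓘(ℂ, ℂ) ω X] in
/-- The image of `x` under the chart at `y₁` lies in the domain of the transition map to the chart at `y₂`,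
when `x` lies in both chart domains. (Auxiliary.) [cite: MochizukiAbsTopIII2015, Corollary 2.7 (e) p.60] -/
theorem extChartAt_mem_transition_source {y₁ y₂ x : X} (h₁ : x ∈ (extChartAt 𝓘(ℂ, ℂ) y₁).source)
    (h₂ : x ∈ (extChartAt 𝓘(ℂ, ℂ) y₂).source) :
    extChartAt 𝓘(ℂ, ℂ) y₁ x ∈ ((extChartAt 𝓘(ℂ, ℂ) y₁).symm ≫ extChartAt 𝓘(ℂ, ℂ) y₂).source := by
  refine ⟨(extChartAt 𝓘(ℂ, ℂ) y₁).map_source h₁, ?_⟩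
  show (extChartAt 𝓘(ℂ, ℂ) y₁).symm (extChartAt 𝓘(ℂ, ℂ) y₁ x) ∈ (extChartAt 𝓘(ℂ, ℂ) y₂).source
  rw [(extChartAt 𝓘(ℂ, ℂ) y₁).left_inv h₁]
  exact h₂

/-- **Transition maps of a Riemann surface are complex-differentiable** at the image of a point of both
chart domains (Mathlib `contDiffWithinAt_ext_coord_change`, `range 𝓘(ℂ, ℂ) = univ`). (Auxiliary.)
[cite: MochizukiAbsTopIII2015, Corollary 2.7 (e) p.60] -/
theorem hasDerivAt_extChartAt_transition {y₁ y₂ x : X} (h₁ : x ∈ (extChartAt 𝓘(ℂ, ℂ) y₁).source)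
    (h₂ : x ∈ (extChartAt 𝓘(ℂ, ℂ) y₂).source) :
    HasDerivAt (extChartAt 𝓘(ℂ, ℂ) y₂ ∘ (extChartAt 𝓘(ℂ, ℂ) y₁).symm)
      (deriv (extChartAt 𝓘(ℂ, ℂ) y₂ ∘ (extChartAt 𝓘(ℂ, ℂ) y₁).symm) (extChartAt 𝓘(ℂ, ℂ) y₁ x))
      (extChartAt 𝓘(ℂ, ℂ) y₁ x) := by
  have hmem := extChartAt_mem_transition_source h₁ h₂
  have hcd := contDiffWithinAt_ext_coord_change (I := 𝓘(ℂ, ℂ)) (n := ω) y₂ y₁ hmem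
  rw [ModelWithCorners.range_eq_univ, contDiffWithinAt_univ] at hcd
  exact (hcd.differentiableAt (by simp)).hasDerivAt

omit [IsManifold 𝓘(ℂ, ℂ) ω X] in
/-- The transition map sends the `y₁`-image of `x` to its `y₂`-image. (Auxiliary.)
[cite: MochizukiAbsTopIII2015, Corollary 2.7 (e) p.60] -/
theorem extChartAt_transition_apply {y₁ y₂ x : X} (h₁ : x ∈ (extChartAt 𝓘(ℂ, ℂ) y₁).source) :
    (extChartAt 𝓘(ℂ, ℂ) y₂ ∘ (extChartAt 𝓘(ℂ, ℂ) y₁).symm) (extChartAt 𝓘(ℂ, ℂ) y₁ x) =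
      extChartAt 𝓘(ℂ, ℂ) y₂ x := by
  simp only [Function.comp_apply, (extChartAt 𝓘(ℂ, ℂ) y₁).left_inv h₁]

omit [IsManifold 𝓘(ℂ, ℂ) ω X] in
/-- The two transition maps are inverse to each other near the image point. (Auxiliary.)
[cite: MochizukiAbsTopIII2015, Corollary 2.7 (e) p.60] -/
theorem eventually_transition_symm_comp {y₁ y₂ x : X} (h₁ : x ∈ (extChartAt 𝓘(ℂ, ℂ) y₁).source)
    (h₂ : x ∈ (extChartAt 𝓘(ℂ, ℂ) y₂).source) :
    ∀ᶠ z in 𝓝 (extChartAt 𝓘(ℂ, ℂ) y₁ x),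
      (extChartAt 𝓘(ℂ, ℂ) y₁ ∘ (extChartAt 𝓘(ℂ, ℂ) y₂).symm)
        ((extChartAt 𝓘(ℂ, ℂ) y₂ ∘ (extChartAt 𝓘(ℂ, ℂ) y₁).symm) z) = z := by
  have ht : (extChartAt 𝓘(ℂ, ℂ) y₁).target ∈ 𝓝 (extChartAt 𝓘(ℂ, ℂ) y₁ x) :=
    extChartAt_target_mem_nhds' ((extChartAt 𝓘(ℂ, ℂ) y₁).map_source h₁)
  have hs : (extChartAt 𝓘(ℂ, ℂ) y₁).symm ⁻¹' (extChartAt 𝓘(ℂ, ℂ) y₂).source ∈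
      𝓝 (extChartAt 𝓘(ℂ, ℂ) y₁ x) :=
    extChartAt_preimage_mem_nhds' h₁ ((isOpen_extChartAt_source y₂).mem_nhds h₂)
  filter_upwards [ht, hs] with z hz hz'
  simp only [Function.comp_apply, mem_preimage] at hz' ⊢
  rw [(extChartAt 𝓘(ℂ, ℂ) y₂).left_inv hz', (extChartAt 𝓘(ℂ, ℂ) y₁).right_inv hz]

/-- **The derivatives of the two transition maps are mutually inverse**: with `p₁`, `p₂` the images of `x`
in the two charts, `deriv (chart₁ ∘ chart₂⁻¹) p₂ · deriv (chart₂ ∘ chart₁⁻¹) p₁ = 1`.  In particular both are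
non-zero. [cite: MochizukiAbsTopIII2015, Corollary 2.7 (e) p.60] -/
theorem deriv_extChartAt_transition_mul_eq_one {y₁ y₂ x : X} (h₁ : x ∈ (extChartAt 𝓘(ℂ, ℂ) y₁).source)
    (h₂ : x ∈ (extChartAt 𝓘(ℂ, ℂ) y₂).source) :
    deriv (extChartAt 𝓘(ℂ, ℂ) y₁ ∘ (extChartAt 𝓘(ℂ, ℂ) y₂).symm) (extChartAt 𝓘(ℂ, ℂ) y₂ x) *
      deriv (extChartAt 𝓘(ℂ, ℂ) y₂ ∘ (extChartAt 𝓘(ℂ, ℂ) y₁).symm) (extChartAt 𝓘(ℂ, ℂ) y₁ x) = 1 := by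
  have hT := hasDerivAt_extChartAt_transition h₁ h₂
  have hT' := hasDerivAt_extChartAt_transition h₂ h₁
  rw [← extChartAt_transition_apply (y₂ := y₂) h₁] at hT'
  have hcomp := hT'.comp (extChartAt 𝓘(ℂ, ℂ) y₁ x) hT
  have hid : HasDerivAt (fun z : ℂ => z) _ (extChartAt 𝓘(ℂ, ℂ) y₁ x) :=
    hcomp.congr_of_eventuallyEq ((eventually_transition_symm_comp h₁ h₂).mono fun z hz => hz.symm)
  have huniq := hid.unique (hasDerivAt_id (extChartAt 𝓘(ℂ, ℂ) y₁ x))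
  rw [extChartAt_transition_apply h₁] at huniq
  exact huniq

/-- **[AbsTopIII] Prop 2.6 (a) / Cor 2.7 (e) on a Riemann surface — the multipliers of `𝒜_x` are
chart-independent.**  Let `x` lie in the domains of the charts at `y₁` and `y₂`, with images `p₁`, `p₂`.
Conjugating the affine representative `z ↦ p₁ + c (z − p₁)` of the `𝒜_{p₁}`-germ of multiplier `c` (the
germ model read in the first chart) by the holomorphic transition map to the second chart yields a map
with complex derivative `c` at `p₂`.  So the labelling `ℂ^× ⥲ 𝒜_x` by multipliers (`germAutIsoUnits`) does
not depend on the chart in which the germ group of Cor 2.7 (e) is read, although the transported germ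
itself need not be affine (`germ_conj_not_mem_germAut`).
[cite: MochizukiAbsTopIII2015, Corollary 2.7 (e) p.60] -/
theorem hasDerivAt_extChartAt_transition_conj_mulAffine {y₁ y₂ x : X}
    (h₁ : x ∈ (extChartAt 𝓘(ℂ, ℂ) y₁).source) (h₂ : x ∈ (extChartAt 𝓘(ℂ, ℂ) y₂).source) (c : ℂ) :
    HasDerivAt
      ((extChartAt 𝓘(ℂ, ℂ) y₂ ∘ (extChartAt 𝓘(ℂ, ℂ) y₁).symm) ∘
        (fun z => extChartAt 𝓘(ℂ, ℂ) y₁ x + c * (z - extChartAt 𝓘(ℂ, ℂ) y₁ x)) ∘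
        (extChartAt 𝓘(ℂ, ℂ) y₁ ∘ (extChartAt 𝓘(ℂ, ℂ) y₂).symm))
      c (extChartAt 𝓘(ℂ, ℂ) y₂ x) := by
  set d := deriv (extChartAt 𝓘(ℂ, ℂ) y₂ ∘ (extChartAt 𝓘(ℂ, ℂ) y₁).symm) (extChartAt 𝓘(ℂ, ℂ) y₁ x)
    with hd
  set d' := deriv (extChartAt 𝓘(ℂ, ℂ) y₁ ∘ (extChartAt 𝓘(ℂ, ℂ) y₂).symm) (extChartAt 𝓘(ℂ, ℂ) y₂ x)
    with hd'
  have hT : HasDerivAt (extChartAt 𝓘(ℂ, ℂ) y₂ ∘ (extChartAt 𝓘(ℂ, ℂ) y₁).symm) d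
      (extChartAt 𝓘(ℂ, ℂ) y₁ x) := hasDerivAt_extChartAt_transition h₁ h₂
  have hT' : HasDerivAt (extChartAt 𝓘(ℂ, ℂ) y₁ ∘ (extChartAt 𝓘(ℂ, ℂ) y₂).symm) d'
      (extChartAt 𝓘(ℂ, ℂ) y₂ x) := hasDerivAt_extChartAt_transition h₂ h₁
  have hdd : d' * d = 1 := deriv_extChartAt_transition_mul_eq_one h₁ h₂
  have hdne : d ≠ 0 := by
    intro h; rw [h, mul_zero] at hdd; exact zero_ne_one hdd
  have hd'eq : d' = d⁻¹ := eq_inv_of_mul_eq_one_left hdd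
  rw [hd'eq] at hT'
  exact hasDerivAt_conj_mulAffine c hT hT' (extChartAt_transition_apply h₂) hdne

/-- The same statement with the derivative of the REVERSE transition: conjugating back from the second
chart to the first also preserves multipliers (symmetry of the two charts).
[cite: MochizukiAbsTopIII2015, Corollary 2.7 (e) p.60] -/
theorem hasDerivAt_extChartAt_transition_conj_mulAffine' {y₁ y₂ x : X}
    (h₁ : x ∈ (extChartAt 𝓘(ℂ, ℂ) y₁).source) (h₂ : x ∈ (extChartAt 𝓘(ℂ, ℂ) y₂).source) (c : ℂ) :
    HasDerivAt
      ((extChartAt 𝓘(ℂ, ℂ) y₁ ∘ (extChartAt 𝓘(ℂ, ℂ) y₂).symm) ∘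
        (fun z => extChartAt 𝓘(ℂ, ℂ) y₂ x + c * (z - extChartAt 𝓘(ℂ, ℂ) y₂ x)) ∘
        (extChartAt 𝓘(ℂ, ℂ) y₂ ∘ (extChartAt 𝓘(ℂ, ℂ) y₁).symm))
      c (extChartAt 𝓘(ℂ, ℂ) y₁ x) :=
  hasDerivAt_extChartAt_transition_conj_mulAffine h₂ h₁ c

end Charts

end

end Literature.AnabelianGeometry.AbsoluteAnabelian
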